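import Summits.CriticalPhenomena.PercolationContinuityZ3.Theorems.Transplant.SkelPhiParamsSched
import HarnessLib

/-!
# N1 ({±1} node) fibre schedule: the (D) radius schedule over the two-unit cells WITH A COLUMN-OFFSET SLOT — `Skelφ.concRadii2N P gap gap' E₀ L' off`
# (p2-g7's `concRadii2S` with `rQ/rC := E(…) ⊔ off2 ⊔ off`), its `WFS2`, the column floor `off x ≤ rQ a x` BY CONSTRUCTION, realised values, the linear-growth
# domination `off ≤ E (nQ)` at run pairs; and the q-level wrapper `Skelφ.Prm.schedN S P off` (= `Prm.sched` with the slot) with `schedN_WFS2`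

builds on p205010 (kernel theorem, internal audit signed; external expert review pending) — nothing in this file uses p205010; NOTHING is claimed about
the node `SamePDropOfSkeletonNeg₁` (OPEN).
Status sentence (coordinator 2026-08-20T04:30Z): "θ(p_c) = 0 on ℤ^d, all d ≥ 2 — kernel-verified (Lean 4/Mathlib, standard axioms); internal adversarial
audit SIGNED 2026-08-20 04:29Z; external expert review pending."
Lane `prim-bschramm-*`, seat `prim-bschramm-stmt` (gen 13); helper file (`--supports stmt-CriticalPhenomena-4575 --as helper`); ledger HOME/prim-bschramm-stmt/NEG-PARAMS.md (n10).
WHY (located, stmt-g13 2026-08-21): hp-8's `sepGeomSG₂` over the NON-STEP fine cell map takes the column point as a hypothesis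
`hcol : ∀ a x, ∃ y ∈ VWin ψ (Q x) (rQ a x), ψ y = cen x`, discharged (`Neg.hcol_fine_at`, `hcol_fineSkel`) at any radius `≥ Nrep (cen x) + 1 = ‖rep₂ (cen x)‖₁ + 1` — a PLANAR
ℓ¹-offset (`= ‖x₀·U + x₁·V‖₁`, `U = 800u`, `V = 800v`), NOT the fine-unit offset `off2 P x = ‖cen x‖₁ + 1` that `concRadii2S` builds into `rQ` (fine units can be far smaller than
planar units on one axis).  So the N1 schedule carries the column radius as a SLOT `off : Site 2 → ℕ` inside `rQ/rC`; every `WF2/WFS2` order fact of `concRadii2S` holds verbatim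
(the max only grows the two radii that sit on the large side of every inequality), `colQ` too, and `off x ≤ rQ a x` is definitional.
* §1 **`concRadii2N P gap gap' E₀ L' off`** (+ `@[simp]` fields), `off2_le_rQN`, **`off_le_rQN`**, **`concRadii2N_WFS2 (hgap : ∀ n, 1 ≤ gap n) (hE₀ : 2 ≤ E₀) (hL' : 1 ≤ L')`**;
* §2 realised values `concRadii2N_rE_eq / _ρ_eq / _ρ_le / _rQ_eq / _rC_eq`, the growth lemma `Erad_linear` (`E₀ + c·k ≤ E k` under `c ≤ gap`), and
  **`concRadii2N_rQ_eq_of_norm_le`** (the max is inactive at every pair with `‖x‖₁ ≤ nQ a x` once `off x ≤ c·‖x‖₁ + 1`, `20·rmax ≤ c ≤ gap`, `1 ≤ E₀`);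
* §3 **`Prm.schedN S P off := concRadii2N P (Prm.gap S) 0 (Prm.E₀ S) (Prm.Lp S) off`**, `schedN_eq`, **`schedN_WFS2`**, `off_le_schedN_rQ`.
[cite: KozmaNitzan2024, §4 pp. 25–27, 30–31 (Q_v, M_v, E_{v,x}, H^j_{v,x}); Lemma 12 (p. 24)]
-/

noncomputable section

open scoped Classical

namespace Summit.CriticalPhenomena.PercolationContinuityZ3.Theorems

namespace Transplant

namespace Skelφ

open Literature.Probability.Percolation Literature.Probability.LatticeModels SimpleGraph
open BoxProdZ2 (ConcRadiiG Erad Frad nQ nS Erad_mono Frad_mono Frad_le_Erad nQ_mono nQ_le_nQ_add_three nQ_add_le_nS_succ mem_pair)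
open Skel (E₀_le_Erad E₀_le_Frad Erad_succ_le_Erad_succ)

section Sched

variable (P : PCells2) (gap gap' : ℕ → ℕ) (E₀ L' : ℕ) (off : Site 2 → ℕ)

/-! ## §1 The schedule with a column-offset slot -/

/-- **The (D) radius schedule over the two-unit cells with a column-offset slot `off`**: `concRadii2S` with `rQ := E(nQ) ⊔ off2 ⊔ off`, `rC := E(nQ+4) ⊔ off2 ⊔ off`.
[cite: KozmaNitzan2024, §4 pp. 25–26 (Q_v, M_v)] -/
def concRadii2N : ConcRadiiG where
  rQ := fun a w => max (Erad gap gap' E₀ (nQ a w)) (max (off2 P w) (off w))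
  rM := fun a w => Frad gap gap' E₀ (nQ a w) - L'
  rC := fun a w => max (Erad gap gap' E₀ (nQ a w + 4)) (max (off2 P w) (off w))
  rB := fun a v δ => Erad gap gap' E₀ (nQ a (v + stepVec δ))
  rE := fun a v δ => (concRadii2Of P gap gap' E₀ L').rE a v δ - 1
  ρ := fun a v δ ℓ => (concRadii2Of P gap gap' E₀ L').ρ a v δ ℓ - 2

/-- `rQ a w = E (nQ a w) ⊔ (off2 w ⊔ off w)`. [folklore] -/
@[simp] theorem concRadii2N_rQ (a : ℕ) (w : Site 2) :
    (concRadii2N P gap gap' E₀ L' off).rQ a w = max (Erad gap gap' E₀ (nQ a w)) (max (off2 P w) (off w)) := rfl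

/-- `rC a w = E (nQ a w + 4) ⊔ (off2 w ⊔ off w)`. [folklore] -/
@[simp] theorem concRadii2N_rC (a : ℕ) (w : Site 2) :
    (concRadii2N P gap gap' E₀ L' off).rC a w = max (Erad gap gap' E₀ (nQ a w + 4)) (max (off2 P w) (off w)) := rfl

/-- `rM a w = F (nQ a w) − L'`. [folklore] -/
@[simp] theorem concRadii2N_rM (a : ℕ) (w : Site 2) : (concRadii2N P gap gap' E₀ L' off).rM a w = Frad gap gap' E₀ (nQ a w) - L' := rfl

/-- `rB a v δ = E (nQ a (v + δ))`. [folklore] -/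
@[simp] theorem concRadii2N_rB (a : ℕ) (v : Site 2) (δ : MDir) :
    (concRadii2N P gap gap' E₀ L' off).rB a v δ = Erad gap gap' E₀ (nQ a (v + stepVec δ)) := rfl

/-- `rE a v δ = rE_prod a v δ − 1`. [folklore] -/
@[simp] theorem concRadii2N_rE (a : ℕ) (v : Site 2) (δ : MDir) :
    (concRadii2N P gap gap' E₀ L' off).rE a v δ = (concRadii2Of P gap gap' E₀ L').rE a v δ - 1 := rfl

/-- `ρ a v δ ℓ = ρ_prod a v δ ℓ − 2`. [folklore] -/
@[simp] theorem concRadii2N_ρ (a : ℕ) (v : Site 2) (δ : MDir) (ℓ : ℤ) :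
    (concRadii2N P gap gap' E₀ L' off).ρ a v δ ℓ = (concRadii2Of P gap gap' E₀ L').ρ a v δ ℓ - 2 := rfl

/-- The schedule's radii other than `rQ/rC` are those of `concRadii2S`. [folklore] -/
theorem concRadii2N_eq_S (a : ℕ) (v : Site 2) (δ : MDir) (ℓ : ℤ) :
    (concRadii2N P gap gap' E₀ L' off).rM a v = (concRadii2S P gap gap' E₀ L').rM a v ∧
      (concRadii2N P gap gap' E₀ L' off).rB a v δ = (concRadii2S P gap gap' E₀ L').rB a v δ ∧
      (concRadii2N P gap gap' E₀ L' off).rE a v δ = (concRadii2S P gap gap' E₀ L').rE a v δ ∧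
      (concRadii2N P gap gap' E₀ L' off).ρ a v δ ℓ = (concRadii2S P gap gap' E₀ L').ρ a v δ ℓ := ⟨rfl, rfl, rfl, rfl⟩

/-- The fine-unit column radius is inside `rQ`. [folklore] -/
theorem off2_le_rQN (a : ℕ) (x : Site 2) : off2 P x ≤ (concRadii2N P gap gap' E₀ L' off).rQ a x :=
  (le_max_left _ _).trans (le_max_right _ _)

/-- **THE COLUMN SLOT IS INSIDE `rQ`** by construction: `off x ≤ rQ a x` at every `(a, x)`. [folklore] -/
theorem off_le_rQN (a : ℕ) (x : Site 2) : off x ≤ (concRadii2N P gap gap' E₀ L' off).rQ a x :=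
  (le_max_right _ _).trans (le_max_right _ _)

/-- `E (nQ a x) ≤ rQ a x`. [folklore] -/
theorem Erad_le_rQN (a : ℕ) (x : Site 2) : Erad gap gap' E₀ (nQ a x) ≤ (concRadii2N P gap gap' E₀ L' off).rQ a x := le_max_left _ _

/-- **The schedule satisfies `WFS2`** (every `gap ≥ 1`, `E₀ ≥ 2`, `L' ≥ 1`) — p2-g7's `concRadii2S_WFS2` verbatim: the offset max sits on the large side of every order fact.
[this work] -/
theorem concRadii2N_WFS2 (hgap : ∀ n, 1 ≤ gap n) (hE₀ : 2 ≤ E₀) (hL' : 1 ≤ L') : WFS2 P (concRadii2N P gap gap' E₀ L' off) := by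
  have W := concRadii2Of_WF2 P gap gap' E₀ L'
  have hBC : ∀ a a' v δ, a' ∈ ({a, a + 1} : Finset ℕ) →
      Erad gap gap' E₀ (nQ a' (v + stepVec δ)) ≤ Erad gap gap' E₀ (nQ a v + 3) := fun a a' v δ h => W.BC a a' v δ h
  have hBC' : ∀ a a' v δ, a' ∈ ({a, a + 1} : Finset ℕ) →
      Erad gap gap' E₀ (nQ a (v + stepVec δ)) ≤ Erad gap gap' E₀ (nQ a' (v + stepVec δ) + 3) := fun a a' v δ h => W.BC' a a' v δ h
  have hρQ : ∀ a a' v δ ℓ, a' ∈ ({a, a + 1} : Finset ℕ) → ℓ ≤ 5 * (P.r δ.1 : ℤ) →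
      (concRadii2Of P gap gap' E₀ L').ρ a' v δ ℓ ≤ Erad gap gap' E₀ (nQ a v) := fun a a' v δ ℓ h hℓ => W.ρQ a a' v δ ℓ h hℓ
  have hρE : ∀ a v δ ℓ, (concRadii2Of P gap gap' E₀ L').ρ a v δ ℓ ≤ (concRadii2Of P gap gap' E₀ L').rE a v δ := W.ρE
  have hEB : ∀ a v δ, (concRadii2Of P gap gap' E₀ L').rE a v δ ≤ Erad gap gap' E₀ (nQ a (v + stepVec δ)) := W.EB
  have h34 : ∀ a v, Erad gap gap' E₀ (nQ a v + 3) + 1 ≤ Erad gap gap' E₀ (nQ a v + 4) :=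
    fun a v => Erad_succ_le_Erad_succ gap' E₀ hgap _
  have hE2 : ∀ n, 2 ≤ Erad gap gap' E₀ n := fun n => hE₀.trans (E₀_le_Erad gap gap' E₀ n)
  have hrE2 : ∀ a v δ, 2 ≤ (concRadii2Of P gap gap' E₀ L').rE a v δ := fun a v δ => by
    rw [concRadii2Of_rE]
    exact le_min (hE₀.trans (E₀_le_Frad gap gap' E₀ _)) (hE2 _)
  have hMF : ∀ a v δ, Frad gap gap' E₀ (nQ a (v + stepVec δ)) ≤ (concRadii2Of P gap gap' E₀ L').rE a v δ := fun a v δ => by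
    rw [concRadii2Of_rE]
    exact le_min (Frad_mono gap gap' E₀ (nQ_add_le_nS_succ a v δ)) (Frad_le_Erad gap gap' E₀ _)
  refine ⟨⟨?_, ?_, ?_, ?_, ?_, ?_, ?_, ?_⟩, ?_, ?_, ?_, ?_, ?_, ?_, ?_⟩
  · -- QC
    intro a a' x h
    simp only [concRadii2N_rQ, concRadii2N_rC]
    exact max_le_max (Erad_mono gap gap' E₀ ((nQ_mono (by rcases mem_pair h with rfl | rfl <;> omega) x).trans (Nat.le_add_right _ _)))
      le_rfl
  · -- BC
    intro a a' v δ h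
    simp only [concRadii2N_rB, concRadii2N_rC]
    exact le_max_of_le_left ((hBC a a' v δ h).trans (by have := h34 a v; omega))
  · -- BC'
    intro a a' v δ h
    simp only [concRadii2N_rB, concRadii2N_rC]
    exact le_max_of_le_left ((hBC' a a' v δ h).trans (by have := h34 a' (v + stepVec δ); omega))
  · -- ρQ
    intro a a' v δ ℓ h hℓ
    simp only [concRadii2N_ρ, concRadii2N_rQ]
    exact le_max_of_le_left ((Nat.sub_le _ _).trans (hρQ a a' v δ ℓ h hℓ))
  · -- ρE
    intro a v δ ℓ
    simp only [concRadii2N_ρ, concRadii2N_rE]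
    have := hρE a v δ ℓ; omega
  · -- EB
    intro a v δ
    simp only [concRadii2N_rE, concRadii2N_rB]
    exact (Nat.sub_le _ _).trans (hEB a v δ)
  · -- EQ
    intro a v δ
    simp only [concRadii2N_rE, concRadii2N_rQ]
    exact le_max_of_le_left ((Nat.sub_le _ _).trans (hEB a v δ))
  · -- ME
    intro a v δ
    simp only [concRadii2N_rM, concRadii2N_rE]
    have := hMF a v δ; have := hrE2 a v δ; omega
  · -- BC1
    intro a a' v δ h
    simp only [concRadii2N_rB, concRadii2N_rC]
    exact le_max_of_le_left ((Nat.add_le_add_right (hBC a a' v δ h) 1).trans (h34 a v))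
  · -- BC1'
    intro a a' v δ h
    simp only [concRadii2N_rB, concRadii2N_rC]
    exact le_max_of_le_left ((Nat.add_le_add_right (hBC' a a' v δ h) 1).trans (h34 a' (v + stepVec δ)))
  · -- ρQ1
    intro a a' v δ ℓ h hℓ
    simp only [concRadii2N_ρ, concRadii2N_rQ]
    refine le_max_of_le_left ?_
    have := hρQ a a' v δ ℓ h hℓ; have := hE2 (nQ a v); omega
  · -- ρE1
    intro a v δ ℓ
    simp only [concRadii2N_ρ, concRadii2N_rE]
    have := hρE a v δ ℓ; have := hrE2 a v δ; omega
  · -- EB1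
    intro a v δ
    simp only [concRadii2N_rE, concRadii2N_rB]
    have := hEB a v δ; have := hrE2 a v δ; omega
  · -- EQ1
    intro a v δ
    simp only [concRadii2N_rE, concRadii2N_rQ]
    refine le_max_of_le_left ?_
    have := hEB a v δ; have := hrE2 a v δ; omega
  · -- colQ
    intro a x
    simp only [concRadii2N_rQ]
    exact (le_max_left _ _).trans (le_max_right _ _)

/-! ## §2 Realised values and the domination of the column slot -/

/-- **Realised far-box radius**: `rE a v δ = F (nS a v + 1) − 1` when the next cube is one level up. [folklore] -/
theorem concRadii2N_rE_eq {a : ℕ} {v : Site 2} {δ : MDir} (h : nQ a (v + stepVec δ) = nS a v + 1) :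
    (concRadii2N P gap gap' E₀ L' off).rE a v δ = Frad gap gap' E₀ (nS a v + 1) - 1 := by
  rw [concRadii2N_rE, rE2_eq P gap gap' E₀ L' h]

/-- **Realised corridor profile**: `ρ a v δ ℓ = E (nS a v) − 2` under the product's two order hypotheses. [folklore] -/
theorem concRadii2N_ρ_eq {a : ℕ} {v : Site 2} {δ : MDir} (h1 : nS a v ≤ nQ a (v + stepVec δ)) (h2 : nS a v ≤ nQ (a - 1) v) (ℓ : ℤ) :
    (concRadii2N P gap gap' E₀ L' off).ρ a v δ ℓ = Erad gap gap' E₀ (nS a v) - 2 := by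
  rw [concRadii2N_ρ, ρ2_eq P gap gap' E₀ L' h1 h2 ℓ]

/-- The corridor profile never exceeds `E (nS a v) − 2`. [folklore] -/
theorem concRadii2N_ρ_le (a : ℕ) (v : Site 2) (δ : MDir) (ℓ : ℤ) :
    (concRadii2N P gap gap' E₀ L' off).ρ a v δ ℓ ≤ Erad gap gap' E₀ (nS a v) - 2 := by
  rw [concRadii2N_ρ]; exact Nat.sub_le_sub_right (ρ2_le P gap gap' E₀ L' a v δ ℓ) 2

/-- **Realised cube radius**: the max is inactive once both offsets are `≤ E (nQ a x)`. [folklore] -/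
theorem concRadii2N_rQ_eq {a : ℕ} {x : Site 2} (h2 : off2 P x ≤ Erad gap gap' E₀ (nQ a x)) (h : off x ≤ Erad gap gap' E₀ (nQ a x)) :
    (concRadii2N P gap gap' E₀ L' off).rQ a x = Erad gap gap' E₀ (nQ a x) := by
  rw [concRadii2N_rQ, max_eq_left (max_le h2 h)]

/-- **Realised cell radius**: the max is inactive once both offsets are `≤ E (nQ a x + 4)`. [folklore] -/
theorem concRadii2N_rC_eq {a : ℕ} {x : Site 2} (h2 : off2 P x ≤ Erad gap gap' E₀ (nQ a x + 4)) (h : off x ≤ Erad gap gap' E₀ (nQ a x + 4)) :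
    (concRadii2N P gap gap' E₀ L' off).rC a x = Erad gap gap' E₀ (nQ a x + 4) := by
  rw [concRadii2N_rC, max_eq_left (max_le h2 h)]

variable {gap} in
/-- **Linear growth of the recursion**: `E₀ + c·k ≤ E k` as soon as `c ≤ gap n` everywhere. [folklore] -/
theorem Erad_linear {c : ℕ} (hgap : ∀ n, c ≤ gap n) (k : ℕ) : E₀ + c * k ≤ Erad gap gap' E₀ k := by
  induction k with
  | zero => simp
  | succ k ih =>
    have h1 : Erad gap gap' E₀ k + gap (Erad gap gap' E₀ k) ≤ Erad gap gap' E₀ (k + 1) :=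
      (BoxProdZ2.Erad_add_gap_le_Frad_succ gap gap' E₀ k).trans (Frad_le_Erad gap gap' E₀ _)
    have h2 := hgap (Erad gap gap' E₀ k)
    nlinarith

variable {gap} in
/-- **A linearly bounded column slot is dominated by the recursion**: `off x ≤ c·‖x‖₁ + 1`, `c ≤ gap`, `1 ≤ E₀`, `‖x‖₁ ≤ k` give `off x ≤ E k`. [this work] -/
theorem off_le_Erad_of_linear {c : ℕ} (hgap : ∀ n, c ≤ gap n) (hE₀ : 1 ≤ E₀) {x : Site 2} {k : ℕ} (hk : (x 0).natAbs + (x 1).natAbs ≤ k)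
    (hoff : off x ≤ c * ((x 0).natAbs + (x 1).natAbs) + 1) : off x ≤ Erad gap gap' E₀ k := by
  have h := Erad_linear gap' E₀ hgap k
  have hmono : c * ((x 0).natAbs + (x 1).natAbs) ≤ c * k := Nat.mul_le_mul_left _ hk
  omega

variable {gap} in
/-- **Realised cube radius at a run pair** (`‖x‖₁ ≤ nQ a x`, `KNCells2AnchorNorm`): the max is inactive under `20·rmax ≤ gap` (fine-unit offset) and `off x ≤ c·‖x‖₁ + 1`,
`c ≤ gap` (planar column slot), `1 ≤ E₀`. [this work] -/
theorem concRadii2N_rQ_eq_of_norm_le {c : ℕ} (hgap₂ : ∀ n, 20 * P.rmax ≤ gap n) (hgap : ∀ n, c ≤ gap n) (hE₀ : 1 ≤ E₀) {a : ℕ} {x : Site 2}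
    (hx : (x 0).natAbs + (x 1).natAbs ≤ nQ a x) (hoff : off x ≤ c * ((x 0).natAbs + (x 1).natAbs) + 1) :
    (concRadii2N P gap gap' E₀ L' off).rQ a x = Erad gap gap' E₀ (nQ a x) :=
  concRadii2N_rQ_eq P gap gap' E₀ L' off (off2_le_Erad P gap' E₀ hgap₂ hE₀ hx) (off_le_Erad_of_linear gap' E₀ off hgap hE₀ hx hoff)

end Sched

/-! ## §3 The q-level wrapper with the slot -/

namespace Prm

/-- **The N1 fibre schedule from the inputs `S` with the column slot `off`**: `concRadii2N P (gap S) 0 (E₀ S) (L′ S) off` (= `Prm.sched S P` with the slot). [this work] -/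
def schedN (S : SchedIn) (P : PCells2) (off : Site 2 → ℕ) : ConcRadiiG := concRadii2N P (gap S) (fun _ => 0) (E₀ S) (Lp S) off

/-- The schedule by name. [folklore] -/
theorem schedN_eq (S : SchedIn) (P : PCells2) (off : Site 2 → ℕ) : schedN S P off = concRadii2N P (gap S) (fun _ => 0) (E₀ S) (Lp S) off := rfl

/-- **`WFS2 P (schedN S P off)`** for EVERY input block and slot (every gap `≥ 1`, `E₀ ≥ 2`, `L′ ≥ 1`). [this work] -/
theorem schedN_WFS2 (S : SchedIn) (P : PCells2) (off : Site 2 → ℕ) : WFS2 P (schedN S P off) :=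
  concRadii2N_WFS2 P (gap S) (fun _ => 0) (E₀ S) (Lp S) off (one_le_gap S) (two_le_E₀ S) (one_le_Lp S)

/-- **The column slot is inside the cube radius**: `off x ≤ rQ a x`. [folklore] -/
theorem off_le_schedN_rQ (S : SchedIn) (P : PCells2) (off : Site 2 → ℕ) (a : ℕ) (x : Site 2) : off x ≤ (schedN S P off).rQ a x :=
  off_le_rQN P _ _ _ _ off a x

end Prm

end Skelφ

end Transplant

end Summit.CriticalPhenomena.PercolationContinuityZ3.Theorems

end
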